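import Summits.HodgeConjecture.HodgeConjecture.Theorems.Ring2AbelianAllNonsplitNormObstruction
import Mathlib.Data.Fintype.Parity
import HarnessLib

/-!
# Ring 2 · Weil-type family-coverage census (ring2-b04, gen 40) — NORM-CLASS CRITERIA: which discriminant classes are split

research route conditional on HC_CM; not a corollary; Q11.4-sentence-2 already refuted in dim ≥ 3.
`HC_CM` (`Theses.RankFourFaces.CMAbelianHodge`, by name) does not occur in this file; no case of the Hodge
conjecture is claimed. Cell `pub-hodge-ring2`, seat `ring2-b04` (gen 40), the SPLIT-SPECIAL-FIBRE column of the
cell's `WEIL-FAMILY-COVERAGE.md` (operator «2026-08-22T11:46:08Z», LEAD ruling L88.3).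

## What the column needs from the kernel

A component `(n, K = ℚ(√-d), δ)` of the Weil-type locus (`Ring2.Hypotheses.WeilClassesComponent n d δ`,
`δ = det H ∈ ℚˣ/Nm(K_dˣ)` = `VanGeemen1994.weilNormResidueGroup d`) contains a HYPERBOLIC ("split") member —
`Motives.IsHyperbolicWeilType`: `X × X̂`-type members, products of `n` Weil-type surfaces with hyperbolic `H`, the
uniformly weighted CM product `E_Kⁿ × E_Kⁿ` — iff `δ` is the split class `[(-1)ⁿ]`
(`Ring2.Hypotheses.splitDiscriminantClass n d`; Landherr 1936 / van Geemen (5.4.1), BOTH directions proved in the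
tree: `VanGeemen1994.isHyperbolicWeilType_iff_hasWeilDiscriminantNondeg_split`,
`Ring2.AbelianAll.landherrSplitCriterion_holds`). Writing `δ = [(-1)ⁿ a]` with `a > 0` (van Geemen (5.4.1):
`det H = (-1)ⁿ a`), the row's answer is therefore the ARITHMETIC statement "`a ∈ Nm(K_dˣ)`", i.e.
"`a = x² + d y²` has a rational solution". Only ONE such statement was in the tree
(`Ring2AbelianAll.NonsplitNormObstruction.two_not_mem_normUnitsSubgroup`: `2 ∉ Nm(ℚ(√-3)ˣ)`, descent at `3`).
This file supplies the GENERAL CRITERIA from which every row of the census tables follows by a residue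
computation (`decide`) or an explicit representation:

* §1 `exists_int_of_exists_rat` — clearing denominators: a rational solution of `x² + d y² = a` gives an integral
  solution of `X² + d Y² = a Z²` with `Z ≠ 0`.
* §2 `not_exists_rat_of_inert` — **descent at an INERT prime**: if `p` is a prime with `-d` a non-square mod `p`
  (so `p ∤ d`, `p` inert in `K_d`) and `p ∥ a`, then `a ≠ x² + d y²` over `ℚ` (local obstruction `(a, -d)_p = -1`).
* §3 `not_exists_rat_of_ramified` — **descent at a RAMIFIED prime**: if `p ∥ d` and `a` is a non-square mod `p`
  (so `p ∤ a`), then `a ≠ x² + d y²` over `ℚ`.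
* §4 the NORM SUBGROUP: `mem_normUnitsSubgroup_of_sq_add_mul_sq` (`a = x² + d y² ≠ 0 ⟹ a ∈ Nm(K_dˣ)`, with the
  explicit inverse `(x - y√-d)/a`, `mk_linear_mul_mk_conj_eq_one`),
  `not_mem_normUnitsSubgroup_of_not_exists` (the converse direction), closure under products / quotients
  (`Nm(K_dˣ)` is a subgroup — used for classes such as `6 = 2·3` modulo `Nm(ℚ(√-3)ˣ)` where neither §2 nor §3
  applies directly).
* §5 the CLASS LEVEL: `mk_eq_splitDiscriminantClass_iff` — `[(-1)ⁿ · a] = splitDiscriminantClass n d ↔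
  a ∈ Nm(K_dˣ)`; hence `[(-1)ⁿ a]` is the split class iff `a` is a norm, for every `n`.

All statements are elementary number theory (sums of two squares type descent; Hasse's norm theorem is NOT needed:
we only ever prove non-membership by ONE local obstruction and membership by an explicit representation).
Sorry-free; axioms `propext`, `Classical.choice`, `Quot.sound`; no `def`, no named fact.

## References

* [vanGeemen1994HodgeAV] B. van Geemen, LNM 1594 (1994), 4.14, Lemma 5.2 (3), 5.4 and (5.4.1) ("`H` is hyperbolic
  iff `a ∈ Nm(K^*)`").
* [Landherr1936HermitianForms] W. Landherr, Abh. Math. Sem. Hamburg 11 (1936).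
* [Serre1973] J.-P. Serre, A course in arithmetic, Ch. III §1 (Hilbert symbol), Ch. IV §3.
* [Markman2025SecantWeil] E. Markman, arXiv:2502.03415 (preprint), §1.1 (the invariant `(n, K, det H)`).
-/

noncomputable section

set_option linter.dupNamespace false

open Polynomial
open Literature.AlgebraicGeometry.Motives
open Literature.AlgebraicGeometry.VanGeemen1994
open Summit.HodgeConjecture.HodgeConjecture.Ring2.Hypotheses
open Summit.HodgeConjecture.HodgeConjecture.Ring2.AbelianAll

namespace Summit.HodgeConjecture.HodgeConjecture.Ring2.WeilCoverage

/-! ### §1 Clearing denominators -/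

/-- **Clearing denominators**: a rational solution of `x² + d y² = a` yields integers `X, Y, Z`, `Z ≠ 0`, with
`X² + d Y² = a Z²`.
research route conditional on HC_CM; not a corollary; Q11.4-sentence-2 already refuted in dim ≥ 3. [folklore] -/
theorem exists_int_of_exists_rat {d a : ℕ} (h : ∃ x y : ℚ, x ^ 2 + (d : ℚ) * y ^ 2 = a) :
    ∃ X Y Z : ℤ, Z ≠ 0 ∧ X ^ 2 + (d : ℤ) * Y ^ 2 = (a : ℤ) * Z ^ 2 := by
  obtain ⟨x, y, h⟩ := h
  refine ⟨x.num * y.den, y.num * x.den, x.den * y.den,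
    mul_ne_zero (Int.natCast_ne_zero.2 x.den_nz) (Int.natCast_ne_zero.2 y.den_nz), ?_⟩
  have hx := Rat.mul_den_eq_num x
  have hy := Rat.mul_den_eq_num y
  have hq : ((x.num * y.den : ℤ) : ℚ) ^ 2 + (d : ℚ) * ((y.num * x.den : ℤ) : ℚ) ^ 2 =
      (a : ℚ) * (((x.den : ℤ) * y.den : ℤ) : ℚ) ^ 2 := by
    push_cast
    rw [← hx, ← hy]
    linear_combination ((x.den : ℚ) * y.den) ^ 2 * h
  exact_mod_cast hq

/-! ### §2 Descent at an inert prime -/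

/-- In `ℤ/p` (`p` prime): if `-d` is not a square then `X² + d Y² = 0` forces `X = Y = 0`.
research route conditional on HC_CM; not a corollary; Q11.4-sentence-2 already refuted in dim ≥ 3. [folklore] -/
theorem zmod_eq_zero_of_sq_add_mul_sq_eq_zero {p : ℕ} [Fact p.Prime] {d : ZMod p} (hres : ¬ IsSquare (-d))
    {X Y : ZMod p} (h : X ^ 2 + d * Y ^ 2 = 0) : X = 0 ∧ Y = 0 := by
  by_cases hY : Y = 0
  · subst hY
    rw [zero_pow two_ne_zero, mul_zero, add_zero] at h
    exact ⟨pow_eq_zero_iff two_ne_zero |>.1 h, rfl⟩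
  · exfalso
    apply hres
    refine ⟨X * Y⁻¹, ?_⟩
    have hX2 : X ^ 2 = -d * Y ^ 2 := by linear_combination h
    have hY2 : Y ^ 2 ≠ 0 := pow_ne_zero 2 hY
    calc -d = -d * Y ^ 2 * (Y ^ 2)⁻¹ := by rw [mul_assoc, mul_inv_cancel₀ hY2, mul_one]
      _ = X ^ 2 * (Y ^ 2)⁻¹ := by rw [← hX2]
      _ = X * Y⁻¹ * (X * Y⁻¹) := by ring

/-- **Descent at an INERT prime (integral form).** Let `p` be a prime with `-d` a non-square modulo `p` and
`p ∥ a` (`p ∣ a`, `p² ∤ a`). Then `X² + d Y² = a Z²` has no integer solution with `Z ≠ 0`: modulo `p` the left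
side vanishes, so `p ∣ X`, `p ∣ Y`; then `p² ∣ a Z²` and `p ∥ a` give `p ∣ Z`, and `(X/p, Y/p, Z/p)` is a smaller
solution. (This is the local obstruction `(a, -d)_p = -1` at a prime inert in `ℚ(√-d)`.)
research route conditional on HC_CM; not a corollary; Q11.4-sentence-2 already refuted in dim ≥ 3. [cite: Serre1973, Ch. III §1] -/
theorem int_descent_inert {d a p : ℕ} (hp : p.Prime) (hres : ¬ IsSquare (-(d : ZMod p)))
    (hpa : p ∣ a) (hpa2 : ¬ p ^ 2 ∣ a) :
    ∀ (m : ℕ) (X Y Z : ℤ), Z.natAbs = m → X ^ 2 + (d : ℤ) * Y ^ 2 = (a : ℤ) * Z ^ 2 → Z = 0 := by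
  haveI := Fact.mk hp
  have hpZ : Prime (p : ℤ) := Nat.prime_iff_prime_int.1 hp
  obtain ⟨a', ha'⟩ := hpa
  have hpa' : ¬ (p : ℤ) ∣ (a' : ℤ) := by
    intro h
    apply hpa2
    rw [ha', pow_two]
    exact Nat.mul_dvd_mul_left p (Int.natCast_dvd_natCast.1 h)
  intro m
  induction m using Nat.strong_induction_on with
  | _ m ih =>
    intro X Y Z hm h
    by_contra hZ
    have hmod : ((X : ZMod p)) ^ 2 + (d : ZMod p) * ((Y : ZMod p)) ^ 2 = 0 := by
      have hc := congrArg (Int.cast : ℤ → ZMod p) h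
      push_cast at hc
      rw [hc, ha', Nat.cast_mul, ZMod.natCast_self, zero_mul, zero_mul]
    obtain ⟨hX0, hY0⟩ := zmod_eq_zero_of_sq_add_mul_sq_eq_zero hres hmod
    obtain ⟨X', hX'⟩ := (ZMod.intCast_zmod_eq_zero_iff_dvd X p).1 hX0
    obtain ⟨Y', hY'⟩ := (ZMod.intCast_zmod_eq_zero_iff_dvd Y p).1 hY0
    -- `p ∣ Z`
    have hZdvd : (p : ℤ) ∣ Z := by
      have h2 : (p : ℤ) * ((p : ℤ) * (X' ^ 2 + (d : ℤ) * Y' ^ 2)) = (p : ℤ) * ((a' : ℤ) * Z ^ 2) := by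
        have haZ : ((a : ℕ) : ℤ) = (p : ℤ) * (a' : ℤ) := by rw [ha']; push_cast; ring
        rw [hX', hY', haZ] at h
        linear_combination h
      have h3 : (p : ℤ) * (X' ^ 2 + (d : ℤ) * Y' ^ 2) = (a' : ℤ) * Z ^ 2 :=
        mul_left_cancel₀ hpZ.ne_zero h2
      have h4 : (p : ℤ) ∣ (a' : ℤ) * Z ^ 2 := ⟨_, h3.symm⟩
      exact hpZ.dvd_of_dvd_pow ((hpZ.dvd_or_dvd h4).resolve_left hpa')
    obtain ⟨Z', hZ'⟩ := hZdvd
    have hZ'0 : Z' ≠ 0 := by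
      rintro rfl
      exact hZ (by rw [hZ', mul_zero])
    -- the smaller solution
    have h' : X' ^ 2 + (d : ℤ) * Y' ^ 2 = (a : ℤ) * Z' ^ 2 := by
      have hp2 : ((p : ℤ) ^ 2) ≠ 0 := pow_ne_zero _ hpZ.ne_zero
      apply mul_left_cancel₀ hp2
      have haZ : ((a : ℕ) : ℤ) = (p : ℤ) * (a' : ℤ) := by rw [ha']; push_cast; ring
      rw [hX', hY', hZ'] at h
      linear_combination h
    have hlt : Z'.natAbs < m := by
      rw [← hm, hZ', Int.natAbs_mul, Int.natAbs_natCast]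
      have hpos : 0 < Z'.natAbs := Int.natAbs_pos.2 hZ'0
      have hp1 : 1 < p := hp.one_lt
      nlinarith
    exact hZ'0 (ih _ hlt X' Y' Z' rfl h')

/-- **No rational solution of `x² + d y² = a` when some prime `p` is inert (`-d` non-square mod `p`) and
`p ∥ a`.** For the census: `a ∉ Nm(ℚ(√-d)ˣ)`, the discriminant class `[(-1)ⁿ a]` is NOT split.
research route conditional on HC_CM; not a corollary; Q11.4-sentence-2 already refuted in dim ≥ 3. [cite: Serre1973, Ch. III §1] -/
theorem not_exists_rat_of_inert {d a p : ℕ} (hp : p.Prime) (hres : ¬ IsSquare (-(d : ZMod p)))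
    (hpa : p ∣ a) (hpa2 : ¬ p ^ 2 ∣ a) : ¬ ∃ x y : ℚ, x ^ 2 + (d : ℚ) * y ^ 2 = a := by
  intro h
  obtain ⟨X, Y, Z, hZ, hXYZ⟩ := exists_int_of_exists_rat h
  exact hZ (int_descent_inert hp hres hpa hpa2 _ X Y Z rfl hXYZ)

/-! ### §3 Descent at a ramified prime -/

/-- In `ℤ/p` (`p` prime): if `a` is not a square then `X² = a Z²` forces `X = Z = 0`.
research route conditional on HC_CM; not a corollary; Q11.4-sentence-2 already refuted in dim ≥ 3. [folklore] -/
theorem zmod_eq_zero_of_sq_eq_mul_sq {p : ℕ} [Fact p.Prime] {a : ZMod p} (hres : ¬ IsSquare a)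
    {X Z : ZMod p} (h : X ^ 2 = a * Z ^ 2) : X = 0 ∧ Z = 0 := by
  by_cases hZ : Z = 0
  · subst hZ
    rw [zero_pow two_ne_zero, mul_zero] at h
    exact ⟨pow_eq_zero_iff two_ne_zero |>.1 h, rfl⟩
  · exfalso
    apply hres
    refine ⟨X * Z⁻¹, ?_⟩
    have hZ2 : Z ^ 2 ≠ 0 := pow_ne_zero 2 hZ
    calc a = a * Z ^ 2 * (Z ^ 2)⁻¹ := by rw [mul_assoc, mul_inv_cancel₀ hZ2, mul_one]
      _ = X ^ 2 * (Z ^ 2)⁻¹ := by rw [← h]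
      _ = X * Z⁻¹ * (X * Z⁻¹) := by ring

/-- **Descent at a RAMIFIED prime (integral form).** Let `p` be a prime with `p ∥ d` and `a` a non-square modulo
`p` (in particular `p ∤ a`). Then `X² + d Y² = a Z²` has no integer solution with `Z ≠ 0`: modulo `p`,
`X² ≡ a Z²` forces `p ∣ X`, `p ∣ Z`; then `p² ∣ d Y²` and `p ∥ d` give `p ∣ Y`; descend. (Local obstruction
`(a, -d)_p = -1` at a prime ramified in `ℚ(√-d)`; the tree's `2 ∉ Nm(ℚ(√-3)ˣ)` is the case `(d, a, p) = (3, 2, 3)`.)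
research route conditional on HC_CM; not a corollary; Q11.4-sentence-2 already refuted in dim ≥ 3. [cite: Serre1973, Ch. III §1] -/
theorem int_descent_ramified {d a p : ℕ} (hp : p.Prime) (hpd : p ∣ d) (hpd2 : ¬ p ^ 2 ∣ d)
    (hres : ¬ IsSquare ((a : ZMod p))) :
    ∀ (m : ℕ) (X Y Z : ℤ), Z.natAbs = m → X ^ 2 + (d : ℤ) * Y ^ 2 = (a : ℤ) * Z ^ 2 → Z = 0 := by
  haveI := Fact.mk hp
  have hpZ : Prime (p : ℤ) := Nat.prime_iff_prime_int.1 hp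
  obtain ⟨d', hd'⟩ := hpd
  have hpd' : ¬ (p : ℤ) ∣ (d' : ℤ) := by
    intro h
    apply hpd2
    rw [hd', pow_two]
    exact Nat.mul_dvd_mul_left p (Int.natCast_dvd_natCast.1 h)
  intro m
  induction m using Nat.strong_induction_on with
  | _ m ih =>
    intro X Y Z hm h
    by_contra hZ
    have hmod : ((X : ZMod p)) ^ 2 = (a : ZMod p) * ((Z : ZMod p)) ^ 2 := by
      have hc := congrArg (Int.cast : ℤ → ZMod p) h
      push_cast at hc
      rw [hd', Nat.cast_mul, ZMod.natCast_self, zero_mul, zero_mul, add_zero] at hc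
      exact hc
    obtain ⟨hX0, hZ0⟩ := zmod_eq_zero_of_sq_eq_mul_sq hres hmod
    obtain ⟨X', hX'⟩ := (ZMod.intCast_zmod_eq_zero_iff_dvd X p).1 hX0
    obtain ⟨Z', hZ'⟩ := (ZMod.intCast_zmod_eq_zero_iff_dvd Z p).1 hZ0
    have hZ'0 : Z' ≠ 0 := by
      rintro rfl
      exact hZ (by rw [hZ', mul_zero])
    -- `p ∣ Y`
    have hYdvd : (p : ℤ) ∣ Y := by
      have h2 : (p : ℤ) * ((d' : ℤ) * Y ^ 2) = (p : ℤ) * ((p : ℤ) * ((a : ℤ) * Z' ^ 2 - X' ^ 2)) := by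
        have hdZ : ((d : ℕ) : ℤ) = (p : ℤ) * (d' : ℤ) := by rw [hd']; push_cast; ring
        rw [hX', hZ', hdZ] at h
        linear_combination h
      have h3 : (d' : ℤ) * Y ^ 2 = (p : ℤ) * ((a : ℤ) * Z' ^ 2 - X' ^ 2) := mul_left_cancel₀ hpZ.ne_zero h2
      have h4 : (p : ℤ) ∣ (d' : ℤ) * Y ^ 2 := ⟨_, h3⟩
      exact hpZ.dvd_of_dvd_pow ((hpZ.dvd_or_dvd h4).resolve_left hpd')
    obtain ⟨Y', hY'⟩ := hYdvd
    have h' : X' ^ 2 + (d : ℤ) * Y' ^ 2 = (a : ℤ) * Z' ^ 2 := by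
      have hp2 : ((p : ℤ) ^ 2) ≠ 0 := pow_ne_zero _ hpZ.ne_zero
      apply mul_left_cancel₀ hp2
      have hdZ : ((d : ℕ) : ℤ) = (p : ℤ) * (d' : ℤ) := by rw [hd']; push_cast; ring
      rw [hX', hY', hZ'] at h
      linear_combination h
    have hlt : Z'.natAbs < m := by
      rw [← hm, hZ', Int.natAbs_mul, Int.natAbs_natCast]
      have hpos : 0 < Z'.natAbs := Int.natAbs_pos.2 hZ'0
      have hp1 : 1 < p := hp.one_lt
      nlinarith
    exact hZ'0 (ih _ hlt X' Y' Z' rfl h')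

/-- **No rational solution of `x² + d y² = a` when some prime `p ∥ d` has `a` a non-square mod `p`.**
For the census: `a ∉ Nm(ℚ(√-d)ˣ)`, the class `[(-1)ⁿ a]` is NOT split.
research route conditional on HC_CM; not a corollary; Q11.4-sentence-2 already refuted in dim ≥ 3. [cite: Serre1973, Ch. III §1] -/
theorem not_exists_rat_of_ramified {d a p : ℕ} (hp : p.Prime) (hpd : p ∣ d) (hpd2 : ¬ p ^ 2 ∣ d)
    (hres : ¬ IsSquare ((a : ZMod p))) : ¬ ∃ x y : ℚ, x ^ 2 + (d : ℚ) * y ^ 2 = a := by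
  intro h
  obtain ⟨X, Y, Z, hZ, hXYZ⟩ := exists_int_of_exists_rat h
  exact hZ (int_descent_ramified hp hpd hpd2 hres _ X Y Z rfl hXYZ)

/-! ### §4 The norm subgroup `Nm(K_dˣ) ≤ ℚˣ` -/

/-- The explicit inverse of `x + y√-d` when `a = x² + d y² ≠ 0`: `(x + y√-d)(x/a - (y/a)√-d) = 1` in
`K_d = ℚ[X]/(X² + d)` (polynomial identity `(yX + x)(-(y/a)X + x/a) - 1 = (X² + d)·(-y²/a)`).
research route conditional on HC_CM; not a corollary; Q11.4-sentence-2 already refuted in dim ≥ 3. [folklore] -/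
theorem mk_linear_mul_mk_conj_eq_one {d : ℕ} {a : ℚ} (ha : a ≠ 0) (x y : ℚ) (h : x ^ 2 + (d : ℚ) * y ^ 2 = a) :
    AdjoinRoot.mk (X ^ 2 + C (d : ℚ)) (C y * X + C x) *
        AdjoinRoot.mk (X ^ 2 + C (d : ℚ)) (C (-y / a) * X + C (x / a)) = 1 := by
  rw [← map_mul, ← map_one (AdjoinRoot.mk (X ^ 2 + C (d : ℚ))), AdjoinRoot.mk_eq_mk]
  refine ⟨C (-y ^ 2 / a), ?_⟩
  have hC : C a⁻¹ * (C x ^ 2 + C (d : ℚ) * C y ^ 2) = (1 : ℚ[X]) := by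
    rw [← C_pow, ← C_pow, ← C_mul, ← C_add, ← C_mul, h, inv_mul_cancel₀ ha, C_1]
  have e1 : C (x / a) = C x * C a⁻¹ := by rw [div_eq_mul_inv, C_mul]
  have e2 : C (-y / a) = -(C y * C a⁻¹) := by rw [div_eq_mul_inv, C_mul, C_neg, neg_mul]
  have e3 : C (-y ^ 2 / a) = -(C y ^ 2 * C a⁻¹) := by rw [div_eq_mul_inv, C_mul, C_neg, C_pow, neg_mul]
  rw [e1, e2, e3]
  linear_combination hC

/-- **A representation `a = x² + d y²` (`a ≠ 0`) puts `a` in `Nm(K_dˣ)`**: `a = Nm(x + y√-d)`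
(`Ring2.AbelianAll.norm_weilField_mk`), and `x + y√-d` is a unit with inverse `(x - y√-d)/a`
(`mk_linear_mul_mk_conj_eq_one`). research route conditional on HC_CM; not a corollary; Q11.4-sentence-2 already refuted in dim ≥ 3.
[cite: vanGeemen1994HodgeAV, 4.14] -/
theorem mem_normUnitsSubgroup_of_sq_add_mul_sq {d : ℕ} {a : ℚ} (ha : a ≠ 0) (x y : ℚ)
    (h : x ^ 2 + (d : ℚ) * y ^ 2 = a) :
    Units.mk0 a ha ∈ normUnitsSubgroup ℚ (weilField d) := by
  refine mem_normUnitsSubgroup_iff.2 ⟨Units.mkOfMulEqOne _ _ (mk_linear_mul_mk_conj_eq_one ha x y h), ?_⟩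
  rw [Units.val_mkOfMulEqOne, Units.val_mk0, norm_weilField_mk, h]

/-- **Conversely, if `a = x² + d y²` has NO rational solution then `a ∉ Nm(K_dˣ)`** (every element of `K_d` is
`x + y√-d`, `Ring2.AbelianAll.exists_eq_mk_linear`, of norm `x² + d y²`).
research route conditional on HC_CM; not a corollary; Q11.4-sentence-2 already refuted in dim ≥ 3. [cite: vanGeemen1994HodgeAV, 4.14] -/
theorem not_mem_normUnitsSubgroup_of_not_exists {d : ℕ} {a : ℚ} (ha : a ≠ 0)
    (h : ¬ ∃ x y : ℚ, x ^ 2 + (d : ℚ) * y ^ 2 = a) :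
    Units.mk0 a ha ∉ normUnitsSubgroup ℚ (weilField d) := by
  intro hmem
  obtain ⟨k, hk⟩ := mem_normUnitsSubgroup_iff.1 hmem
  obtain ⟨x, y, hxy⟩ := exists_eq_mk_linear d (k : weilField d)
  apply h
  refine ⟨x, y, ?_⟩
  have := hk
  rw [hxy, norm_weilField_mk] at this
  exact this

/-- **`a ∈ Nm(K_dˣ)` iff `a = x² + d y²` has a rational solution** (`a ≠ 0`).
research route conditional on HC_CM; not a corollary; Q11.4-sentence-2 already refuted in dim ≥ 3. [cite: vanGeemen1994HodgeAV, 4.14] -/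
theorem mem_normUnitsSubgroup_iff_exists {d : ℕ} {a : ℚ} (ha : a ≠ 0) :
    Units.mk0 a ha ∈ normUnitsSubgroup ℚ (weilField d) ↔ ∃ x y : ℚ, x ^ 2 + (d : ℚ) * y ^ 2 = a := by
  refine ⟨fun hmem => ?_, fun ⟨x, y, h⟩ => mem_normUnitsSubgroup_of_sq_add_mul_sq ha x y h⟩
  by_contra h
  exact not_mem_normUnitsSubgroup_of_not_exists ha h hmem

/-- **Inert-prime obstruction at the level of `Nm(K_dˣ)`**: `p` prime, `-d` non-square mod `p`, `p ∥ a` ⟹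
`a ∉ Nm(K_dˣ)`. research route conditional on HC_CM; not a corollary; Q11.4-sentence-2 already refuted in dim ≥ 3.
[cite: Serre1973, Ch. III §1] -/
theorem natCast_not_mem_normUnitsSubgroup_of_inert {d a p : ℕ} (hp : p.Prime) (hres : ¬ IsSquare (-(d : ZMod p)))
    (hpa : p ∣ a) (hpa2 : ¬ p ^ 2 ∣ a) (ha : (a : ℚ) ≠ 0) :
    Units.mk0 (a : ℚ) ha ∉ normUnitsSubgroup ℚ (weilField d) :=
  not_mem_normUnitsSubgroup_of_not_exists ha (not_exists_rat_of_inert hp hres hpa hpa2)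

/-- **Ramified-prime obstruction at the level of `Nm(K_dˣ)`**: `p` prime, `p ∥ d`, `a` non-square mod `p` ⟹
`a ∉ Nm(K_dˣ)`. research route conditional on HC_CM; not a corollary; Q11.4-sentence-2 already refuted in dim ≥ 3.
[cite: Serre1973, Ch. III §1] -/
theorem natCast_not_mem_normUnitsSubgroup_of_ramified {d a p : ℕ} (hp : p.Prime) (hpd : p ∣ d)
    (hpd2 : ¬ p ^ 2 ∣ d) (hres : ¬ IsSquare ((a : ZMod p))) (ha : (a : ℚ) ≠ 0) :
    Units.mk0 (a : ℚ) ha ∉ normUnitsSubgroup ℚ (weilField d) :=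
  not_mem_normUnitsSubgroup_of_not_exists ha (not_exists_rat_of_ramified hp hpd hpd2 hres)

/-- **Quotients**: if `a ∈ Nm(K_dˣ)` and `b ∉ Nm(K_dˣ)` then `a·b ∉ Nm(K_dˣ)` (the norm group is a subgroup; used
for classes like `6 = 3·2` modulo `Nm(ℚ(√-3)ˣ)`, where no single prime gives a direct descent).
research route conditional on HC_CM; not a corollary; Q11.4-sentence-2 already refuted in dim ≥ 3. [folklore] -/
theorem mul_not_mem_normUnitsSubgroup {d : ℕ} {u v : ℚˣ} (hu : u ∈ normUnitsSubgroup ℚ (weilField d))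
    (hv : v ∉ normUnitsSubgroup ℚ (weilField d)) : u * v ∉ normUnitsSubgroup ℚ (weilField d) := by
  intro huv
  apply hv
  have := Subgroup.mul_mem _ (Subgroup.inv_mem _ hu) huv
  rwa [inv_mul_cancel_left] at this

/-- `Units.mk0` is multiplicative (bookkeeping for the tables).
research route conditional on HC_CM; not a corollary; Q11.4-sentence-2 already refuted in dim ≥ 3. [folklore] -/
theorem mk0_mul_mk0 {a b : ℚ} (ha : a ≠ 0) (hb : b ≠ 0) :
    Units.mk0 a ha * Units.mk0 b hb = Units.mk0 (a * b) (mul_ne_zero ha hb) := by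
  ext
  rfl

/-- Squares of non-zero rationals are norms (`q² = Nm(q)`).
research route conditional on HC_CM; not a corollary; Q11.4-sentence-2 already refuted in dim ≥ 3. [folklore] -/
theorem sq_mem_normUnitsSubgroup {d : ℕ} {q : ℚ} (hq : q ≠ 0) :
    Units.mk0 (q ^ 2) (pow_ne_zero 2 hq) ∈ normUnitsSubgroup ℚ (weilField d) :=
  mem_normUnitsSubgroup_of_sq_add_mul_sq _ q 0 (by ring)

/-! ### §5 Class level: when is `[(-1)ⁿ a]` the split class? -/

/-- **`[(-1)ⁿ · u] = splitDiscriminantClass n d ↔ u ∈ Nm(K_dˣ)`**: the discriminant class `det H = (-1)ⁿ a`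
(van Geemen (5.4.1)) is the split (hyperbolic) class iff `a` is a norm from `K_d = ℚ(√-d)`.
research route conditional on HC_CM; not a corollary; Q11.4-sentence-2 already refuted in dim ≥ 3. [cite: vanGeemen1994HodgeAV, 5.4 and (5.4.1)] -/
theorem mk_neg_one_pow_mul_eq_splitDiscriminantClass_iff {d : ℕ} (n : ℕ) (u : ℚˣ) :
    (QuotientGroup.mk ((-1 : ℚˣ) ^ n * u) : weilNormResidueGroup d) = splitDiscriminantClass n d ↔
      u ∈ normUnitsSubgroup ℚ (weilField d) := by
  rw [splitDiscriminantClass, QuotientGroup.eq, mul_inv_rev, mul_assoc, inv_mul_cancel, mul_one]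
  exact Subgroup.inv_mem_iff _

/-- The same with the sign written on the other side: `[u] = splitDiscriminantClass n d ↔ (-1)ⁿ · u ∈ Nm(K_dˣ)`.
research route conditional on HC_CM; not a corollary; Q11.4-sentence-2 already refuted in dim ≥ 3. [cite: vanGeemen1994HodgeAV, 5.4 and (5.4.1)] -/
theorem mk_eq_splitDiscriminantClass_iff {d : ℕ} (n : ℕ) (u : ℚˣ) :
    (QuotientGroup.mk u : weilNormResidueGroup d) = splitDiscriminantClass n d ↔
      (-1 : ℚˣ) ^ n * u ∈ normUnitsSubgroup ℚ (weilField d) := by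
  have h := mk_neg_one_pow_mul_eq_splitDiscriminantClass_iff (d := d) n ((-1 : ℚˣ) ^ n * u)
  rw [← mul_assoc, ← mul_pow, neg_mul_neg, one_mul, one_pow, one_mul] at h
  exact h

/-- **Split criterion for the census rows, `n` EVEN** (`g = 2n ∈ {4, 8, 12, …}`, `δ = det H = a > 0`): the
component `(n, ℚ(√-d), [a])` is the split one iff `a ∈ Nm(K_dˣ)`.
research route conditional on HC_CM; not a corollary; Q11.4-sentence-2 already refuted in dim ≥ 3. [cite: vanGeemen1994HodgeAV, (5.4.1)] -/
theorem mk_eq_splitDiscriminantClass_iff_of_even {d n : ℕ} (hn : Even n) (u : ℚˣ) :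
    (QuotientGroup.mk u : weilNormResidueGroup d) = splitDiscriminantClass n d ↔
      u ∈ normUnitsSubgroup ℚ (weilField d) := by
  rw [mk_eq_splitDiscriminantClass_iff, hn.neg_one_pow, one_mul]

/-- **Split criterion for the census rows, `n` ODD** (`g = 2n ∈ {2, 6, 10, …}`, `δ = det H = -a < 0`): the
component `(n, ℚ(√-d), [-a])` is the split one iff `a ∈ Nm(K_dˣ)`.
research route conditional on HC_CM; not a corollary; Q11.4-sentence-2 already refuted in dim ≥ 3. [cite: vanGeemen1994HodgeAV, (5.4.1)] -/
theorem mk_neg_eq_splitDiscriminantClass_iff_of_odd {d n : ℕ} (hn : Odd n) (u : ℚˣ) :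
    (QuotientGroup.mk (-u) : weilNormResidueGroup d) = splitDiscriminantClass n d ↔
      u ∈ normUnitsSubgroup ℚ (weilField d) := by
  rw [mk_eq_splitDiscriminantClass_iff, hn.neg_one_pow, neg_one_mul, neg_neg]

end Summit.HodgeConjecture.HodgeConjecture.Ring2.WeilCoverage

end
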